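import Literature.Analysis.Calculus.NewtonSplitThreeFormalJets
import HarnessLib

/-!
# Split smooth Newton theorem `S₂ ⊂ S₃`, formal part along the axis, II: Borel summation and flatness

Topic `Analysis/Calculus`; cell `pub/hodgecm-mathlib`, N8-INNER brick (10)(A′) «SPLIT NEWTON `S₂ ⊂ S₃`» (sigsheet
`SIGSHEET-NewtonSplitThree.v1`, file F2, part II).  Count-neutral Literature THEOREMS (`--kind proof --supports
stmt-HodgeConjecture-24833`); no `def`, no instance, no notation, no `sorry`; frame of ★ `FlatCubeRootDescentReal`.

THE HEAD `exists_contDiff_sub_sum_pow_smul_comp_cusp_isBigO`: for a smooth `H : ℝ × ℝ × P → E` (variables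
`(u, t, z)`, `u` first) there are smooth `G₀, G₁, G₂ : ℝ × ℝ × P → E` (variables `(u, v, z)`) such that
`H (u, t, z) − Σ_{k<3} t^k • G_k (u, (t³ − 3ut)/2, z)` is FLAT ALONG THE HYPERPLANE `u = 0`, in the value currency
`= O(|u|^N)` near every `(0, t₀, z₀)`, for every `N`.  Proof: ★ part I gives the jet sequence `γ_{n,k}` solving the
triangular system (EQ_m); Borel's lemma in `u` with parameter `(v, z)` (★ `BorelCutoffSeriesBanach`) gives `G_k` with
`∂ᵤⁿ G_k (0, v, z) = γ_{n,k} (v, z)`; then three one-variable Taylor expansions (★ `TaylorValueFlatParam`: `H` in `u`;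
`G_k` in `u` at the moving parameter `v = (t³−3ut)/2`; `γ_{n,k}` in `w` at `t³/2`, evaluated at `w = −(3t/2)u`) and the
identities (EQ_m), `m ≤ N`, leave only monomials `u^{n+b}` with `n + b > N`.  No mixed partials, no composite-jet
formula.  The cusp substitution `v = (t³ − 3ut)/2` is the split-Newton one: with `t = p + q`, `u = pq` one has
`v = (p³ + q³)/2` (file F3 `NewtonSplitThree`).
HONEST LABEL: count-neutral Mathlib-side analysis; HC_CM is proved only modulo the printed citations (hLiu418 =
`stmt-HodgeConjecture-24832`, h413 = `stmt-HodgeConjecture-24833`) until rung 0 closes.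

## References
* [Whitney1943] H. Whitney, *Differentiable even functions*, Duke Math. J. 10 (1943) 159–160 («formal + flat»).
* [Glaeser1963Newton] G. Glaeser, *Fonctions composées différentiables*, Ann. of Math. 77 (1963) 193–209, Thm. II.
* [HormanderALPDO1] L. Hörmander, *The Analysis of Linear Partial Differential Operators I*, §1.1 (1.1.7)–(1.1.8),
  §1.2 Thm. 1.2.6 (Borel).
-/

noncomputable section

open Set Function Filter Topology Finset Asymptotics
open scoped ContDiff Nat

namespace Literature.Analysis.Calculus

universe u

section Aux

variable {P : Type u} [NormedAddCommGroup P] {E : Type u} [NormedAddCommGroup E] [NormedSpace ℝ E]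

/-- A monomial `uᵐ` times a coefficient continuous at the base point is `O(|u|^m)` there (variables `(u, t, z)`).
[folklore] [cite: HormanderALPDO1, §1.1 (1.1.8)] -/
theorem isBigO_fst_pow_smul_of_continuousAt {c : ℝ × ℝ × P → E} {t₀ : ℝ} {z₀ : P}
    (hc : ContinuousAt c ((0, t₀, z₀) : ℝ × ℝ × P)) (m : ℕ) :
    (fun q : ℝ × ℝ × P => q.1 ^ m • c q) =O[𝓝 ((0, t₀, z₀) : ℝ × ℝ × P)] fun q => ‖q.1‖ ^ m := by
  have h1 : c =O[𝓝 ((0, t₀, z₀) : ℝ × ℝ × P)] fun _ => (1 : ℝ) := hc.tendsto.isBigO_one ℝ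
  have h2 : (fun q : ℝ × ℝ × P => q.1 ^ m) =O[𝓝 ((0, t₀, z₀) : ℝ × ℝ × P)] fun q => q.1 ^ m :=
    isBigO_refl _ _
  have h3 := h2.smul h1
  simp only [smul_eq_mul, mul_one] at h3
  refine h3.trans ?_
  refine IsBigO.of_bound 1 (Eventually.of_forall fun q => ?_)
  rw [norm_pow, one_mul, Real.norm_of_nonneg (pow_nonneg (norm_nonneg _) _)]

/-- Weakening the exponent of `|u|` near `u = 0`. [folklore] [cite: HormanderALPDO1, §1.1 (1.1.8)] -/
theorem isBigO_norm_fst_pow_of_le (t₀ : ℝ) (z₀ : P) {n m : ℕ} (h : n ≤ m) :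
    (fun q : ℝ × ℝ × P => ‖q.1‖ ^ m) =O[𝓝 ((0, t₀, z₀) : ℝ × ℝ × P)] fun q => ‖q.1‖ ^ n := by
  refine IsBigO.of_bound 1 ?_
  have hball : ∀ᶠ q : ℝ × ℝ × P in 𝓝 ((0, t₀, z₀) : ℝ × ℝ × P), ‖q.1‖ ≤ 1 := by
    have : Metric.ball ((0, t₀, z₀) : ℝ × ℝ × P) 1 ∈ 𝓝 ((0, t₀, z₀) : ℝ × ℝ × P) :=
      Metric.ball_mem_nhds _ one_pos
    filter_upwards [this] with q hq
    rw [Metric.mem_ball, Prod.dist_eq, max_lt_iff, dist_zero_right] at hq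
    exact hq.1.le
  filter_upwards [hball] with q hq
  rw [one_mul, Real.norm_of_nonneg (pow_nonneg (norm_nonneg _) _),
    Real.norm_of_nonneg (pow_nonneg (norm_nonneg _) _)]
  exact pow_le_pow_of_le_one (norm_nonneg _) hq h

/-- Square truncation = triangular part + high part, the triangular part regrouped by antidiagonals.
[folklore] [cite: HormanderALPDO1, §1.1 (1.1.7)′] -/
theorem sum_range_sq_eq_sum_antidiagonal_add {M' : Type*} [AddCommMonoid M'] (X : ℕ × ℕ → M') (N : ℕ) :
    ∑ p ∈ Finset.range (N + 1) ×ˢ Finset.range (N + 1), X p =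
      ∑ m ∈ Finset.range (N + 1), ∑ p ∈ antidiagonal m, X p +
        ∑ p ∈ (Finset.range (N + 1) ×ˢ Finset.range (N + 1)).filter (fun p => ¬ p.1 + p.2 ≤ N), X p := by
  rw [← Finset.sum_filter_add_sum_filter_not (Finset.range (N + 1) ×ˢ Finset.range (N + 1))
    (fun p : ℕ × ℕ => p.1 + p.2 ≤ N)]
  congr 1
  rw [← Finset.sum_fiberwise_of_maps_to
    (s := (Finset.range (N + 1) ×ˢ Finset.range (N + 1)).filter (fun p : ℕ × ℕ => p.1 + p.2 ≤ N))
    (t := Finset.range (N + 1)) (g := fun p : ℕ × ℕ => p.1 + p.2) ?_]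
  · refine Finset.sum_congr rfl fun m hm => ?_
    have hmN : m < N + 1 := Finset.mem_range.1 hm
    congr 1
    ext p
    simp only [Finset.mem_filter, Finset.mem_product, Finset.mem_range, HasAntidiagonal.mem_antidiagonal]
    omega
  · intro p hp
    simp only [Finset.mem_filter, Finset.mem_product, Finset.mem_range] at hp
    simp only [Finset.mem_range]
    omega

end Aux

variable {P : Type u} [NormedAddCommGroup P] [NormedSpace ℝ P] [FiniteDimensional ℝ P]
  {E : Type u} [NormedAddCommGroup E] [NormedSpace ℝ E] [CompleteSpace E]

/-- **Formal part of the split smooth Newton theorem, along the axis `u = 0`.** For a smooth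
`H : ℝ × ℝ × P → E` (variables `(u, t, z)`) there are smooth `G k : ℝ × ℝ × P → E` (`k < 3`, variables `(u, v, z)`)
such that `H (u, t, z) − Σ_k t^k • G_k (u, (t³ − 3ut)/2, z) = O(|u|^N)` near every point `(0, t₀, z₀)` of the axis,
for every `N`. [folklore] [cite: Whitney1943, Thm. 1] [cite: Glaeser1963Newton, Thm. II]
[cite: HormanderALPDO1, §1.2 Thm. 1.2.6; §1.1 (1.1.7)–(1.1.8)] -/
theorem exists_contDiff_sub_sum_pow_smul_comp_cusp_isBigO (H : ℝ × ℝ × P → E) (hH : ContDiff ℝ ∞ H) :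
    ∃ G : Fin 3 → ℝ × ℝ × P → E, (∀ k, ContDiff ℝ ∞ (G k)) ∧ ∀ (t₀ : ℝ) (z₀ : P) (N : ℕ),
      (fun q : ℝ × ℝ × P => H q -
        ∑ k : Fin 3, q.2.1 ^ (k : ℕ) • G k (q.1, (q.2.1 ^ 3 - 3 * q.1 * q.2.1) / 2, q.2.2))
        =O[𝓝 ((0, t₀, z₀) : ℝ × ℝ × P)] fun q => ‖q.1‖ ^ N := by
  classical
  obtain ⟨γ, hγs, hEQ⟩ := exists_cuspJetSequence H hH
  -- Borel in `u` with parameter `(v, z) : ℝ × P`, once for each `k`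
  have hBorel : ∀ k : Fin 3, ∃ W : ℝ × (ℝ × P) → E, ContDiff ℝ ∞ W ∧
      ∀ (y : ℝ × P) (n : ℕ), iteratedDeriv n (fun u => W (u, y)) 0 = γ n k y :=
    fun k => exists_contDiff_iteratedDeriv_zeroSection_eq_of_finiteDimensional (fun n => γ n k) (fun n => hγs n k)
  choose W hWs hWj using hBorel
  refine ⟨W, hWs, fun t₀ z₀ N => ?_⟩
  -- notation: the shifted jets `d b n k (t, z) = ∂_w^b γ_{n,k} (t³/2 + w, z)|₀` and the `u`-jets of `H`
  set d : ℕ → ℕ → Fin 3 → ℝ × P → E := fun b n k y =>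
    iteratedDeriv b (fun w => γ n k (y.1 ^ 3 / 2 + w, y.2)) 0 with hd
  have hdc : ∀ b n k, Continuous (d b n k) := fun b n k => (contDiff_iteratedDeriv_shift_cube (hγs n k) b).continuous
  set h : ℕ → ℝ × P → E := fun m y => iteratedDeriv m (fun u => H (u, y.1, y.2)) 0 with hh
  -- (T1) Taylor for `H` in `u`
  have hT1 : (fun q : ℝ × ℝ × P => H q - ∑ n ∈ Finset.range (N + 1), (q.1 ^ n / (n ! : ℝ)) • h n q.2)
      =O[𝓝 ((0, t₀, z₀) : ℝ × ℝ × P)] fun q => ‖q.1‖ ^ (N + 1) := by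
    have := isBigO_sub_taylorSum_fst (Y := ℝ × P) H hH (t₀, z₀) N
    refine (this.congr_left fun q => rfl).trans (IsBigO.of_bound 1 (Eventually.of_forall fun q => ?_))
    simp only [one_mul, Real.norm_eq_abs, abs_pow, abs_abs, le_refl]
  -- (T2) Taylor for `W k` in `u` at the moving parameter `v = (t³ − 3ut)/2`
  have hφ : Tendsto (fun q : ℝ × ℝ × P => (q.1, ((q.2.1 ^ 3 - 3 * q.1 * q.2.1) / 2, q.2.2)))
      (𝓝 ((0, t₀, z₀) : ℝ × ℝ × P)) (𝓝 ((0, (t₀ ^ 3 / 2, z₀)) : ℝ × (ℝ × P))) := by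
    have hc : Continuous fun q : ℝ × ℝ × P => (q.1, ((q.2.1 ^ 3 - 3 * q.1 * q.2.1) / 2, q.2.2)) := by
      fun_prop
    have h0 : (fun q : ℝ × ℝ × P => (q.1, ((q.2.1 ^ 3 - 3 * q.1 * q.2.1) / 2, q.2.2))) (0, t₀, z₀) =
        (0, (t₀ ^ 3 / 2, z₀)) := by simp
    simpa [h0] using hc.tendsto ((0, t₀, z₀) : ℝ × ℝ × P)
  have hT2 : ∀ k : Fin 3, (fun q : ℝ × ℝ × P => q.2.1 ^ (k : ℕ) •
      (W k (q.1, ((q.2.1 ^ 3 - 3 * q.1 * q.2.1) / 2, q.2.2)) -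
        ∑ n ∈ Finset.range (N + 1), (q.1 ^ n / (n ! : ℝ)) •
          γ n k ((q.2.1 ^ 3 - 3 * q.1 * q.2.1) / 2, q.2.2)))
      =O[𝓝 ((0, t₀, z₀) : ℝ × ℝ × P)] fun q => ‖q.1‖ ^ (N + 1) := by
    intro k
    have h1 := (isBigO_sub_taylorSum_fst (Y := ℝ × P) (W k) (hWs k) (t₀ ^ 3 / 2, z₀) N).comp_tendsto hφ
    have h2 : (fun q : ℝ × ℝ × P => W k (q.1, ((q.2.1 ^ 3 - 3 * q.1 * q.2.1) / 2, q.2.2)) -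
        ∑ n ∈ Finset.range (N + 1), (q.1 ^ n / (n ! : ℝ)) •
          γ n k ((q.2.1 ^ 3 - 3 * q.1 * q.2.1) / 2, q.2.2))
        =O[𝓝 ((0, t₀, z₀) : ℝ × ℝ × P)] fun q => ‖q.1‖ ^ (N + 1) := by
      refine (h1.congr_left fun q => ?_).trans (IsBigO.of_bound 1 (Eventually.of_forall fun q => ?_))
      · simp only [Function.comp_apply, hWj]
      · simp only [Function.comp_apply, one_mul, Real.norm_eq_abs, abs_pow, abs_abs, le_refl]
    have h3c : Continuous fun q : ℝ × ℝ × P => q.2.1 ^ (k : ℕ) := (continuous_fst.comp continuous_snd).pow _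
    have h3 : (fun q : ℝ × ℝ × P => q.2.1 ^ (k : ℕ)) =O[𝓝 ((0, t₀, z₀) : ℝ × ℝ × P)] fun _ => (1 : ℝ) :=
      (h3c.tendsto _).isBigO_one ℝ
    have := h3.smul h2
    simpa only [one_mul, smul_eq_mul] using this
  -- (T3) Taylor for `γ n k` in `w` at `t³/2`, evaluated at `w = −(3t/2)·u`
  have hψ : Tendsto (fun q : ℝ × ℝ × P => (-(3 : ℝ) / 2 * q.2.1 * q.1, (q.2.1, q.2.2)))
      (𝓝 ((0, t₀, z₀) : ℝ × ℝ × P)) (𝓝 ((0, (t₀, z₀)) : ℝ × (ℝ × P))) := by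
    have hc : Continuous fun q : ℝ × ℝ × P => (-(3 : ℝ) / 2 * q.2.1 * q.1, (q.2.1, q.2.2)) := by fun_prop
    have h0 : (fun q : ℝ × ℝ × P => (-(3 : ℝ) / 2 * q.2.1 * q.1, (q.2.1, q.2.2))) (0, t₀, z₀) =
        (0, (t₀, z₀)) := by simp
    simpa [h0] using hc.tendsto ((0, t₀, z₀) : ℝ × ℝ × P)
  -- `|t u| ≤ C |u|` near the base point
  have htu : (fun q : ℝ × ℝ × P => |-(3 : ℝ) / 2 * q.2.1 * q.1| ^ (N + 1))
      =O[𝓝 ((0, t₀, z₀) : ℝ × ℝ × P)] fun q => ‖q.1‖ ^ (N + 1) := by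
    have h1c : Continuous fun q : ℝ × ℝ × P => (-(3 : ℝ) / 2 * q.2.1) ^ (N + 1) :=
      (continuous_const.mul (continuous_fst.comp continuous_snd)).pow _
    have h1 : (fun q : ℝ × ℝ × P => (-(3 : ℝ) / 2 * q.2.1) ^ (N + 1))
        =O[𝓝 ((0, t₀, z₀) : ℝ × ℝ × P)] fun _ => (1 : ℝ) := (h1c.tendsto _).isBigO_one ℝ
    have h2 : (fun q : ℝ × ℝ × P => q.1 ^ (N + 1)) =O[𝓝 ((0, t₀, z₀) : ℝ × ℝ × P)] fun q => ‖q.1‖ ^ (N + 1) :=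
      IsBigO.of_bound 1 (Eventually.of_forall fun q => by
        simp only [norm_pow, one_mul, Real.norm_eq_abs, abs_abs, le_refl])
    have h3 := h1.mul h2
    simp only [one_mul] at h3
    refine (IsBigO.of_bound 1 (Eventually.of_forall fun q => ?_)).trans h3
    simp only [one_mul, Real.norm_eq_abs, abs_pow, abs_mul, abs_abs, mul_pow, le_refl]
  have hT3 : ∀ (k : Fin 3) (n : ℕ), (fun q : ℝ × ℝ × P => q.2.1 ^ (k : ℕ) • ((q.1 ^ n / (n ! : ℝ)) •
      (γ n k ((q.2.1 ^ 3 - 3 * q.1 * q.2.1) / 2, q.2.2) -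
        ∑ b ∈ Finset.range (N + 1), ((-(3 : ℝ) / 2 * q.2.1 * q.1) ^ b / (b ! : ℝ)) • d b n k (q.2.1, q.2.2))))
      =O[𝓝 ((0, t₀, z₀) : ℝ × ℝ × P)] fun q => ‖q.1‖ ^ (N + 1) := by
    intro k n
    set Γ : ℝ × (ℝ × P) → E := fun q' => γ n k (q'.2.1 ^ 3 / 2 + q'.1, q'.2.2) with hΓ
    have hΓs : ContDiff ℝ ∞ Γ := (hγs n k).comp
      ((((contDiff_fst.comp contDiff_snd).pow 3).div_const 2 |>.add contDiff_fst).prodMk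
        (contDiff_snd.comp contDiff_snd))
    have h1 := (isBigO_sub_taylorSum_fst (Y := ℝ × P) Γ hΓs (t₀, z₀) N).comp_tendsto hψ
    have h2 : (fun q : ℝ × ℝ × P => γ n k ((q.2.1 ^ 3 - 3 * q.1 * q.2.1) / 2, q.2.2) -
        ∑ b ∈ Finset.range (N + 1), ((-(3 : ℝ) / 2 * q.2.1 * q.1) ^ b / (b ! : ℝ)) • d b n k (q.2.1, q.2.2))
        =O[𝓝 ((0, t₀, z₀) : ℝ × ℝ × P)] fun q => ‖q.1‖ ^ (N + 1) := by
      refine (h1.congr_left fun q => ?_).trans htu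
      simp only [Function.comp_apply, hΓ, hd]
      congr 2
      ring
    -- bounded scalar prefactors
    have h3c : Continuous fun q : ℝ × ℝ × P => q.2.1 ^ (k : ℕ) * (q.1 ^ n / (n ! : ℝ)) :=
      ((continuous_fst.comp continuous_snd).pow _).mul ((continuous_fst.pow _).div_const _)
    have h3 : (fun q : ℝ × ℝ × P => q.2.1 ^ (k : ℕ) * (q.1 ^ n / (n ! : ℝ)))
        =O[𝓝 ((0, t₀, z₀) : ℝ × ℝ × P)] fun _ => (1 : ℝ) := (h3c.tendsto _).isBigO_one ℝ
    have := h3.smul h2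
    simp only [smul_eq_mul, one_mul] at this
    refine this.congr_left fun q => ?_
    rw [smul_smul]
  -- (T4) the high monomials `u^{n+b}`, `n + b > N`
  set X : ℕ × ℕ → ℝ × ℝ × P → E := fun p q => ∑ k : Fin 3,
    (q.1 ^ (p.1 + p.2) * ((-(3 : ℝ) / 2 * q.2.1) ^ p.2 * q.2.1 ^ (k : ℕ) / ((p.1 ! : ℝ) * p.2 !))) •
      d p.2 p.1 k (q.2.1, q.2.2) with hX
  have hT4 : ∀ p ∈ (Finset.range (N + 1) ×ˢ Finset.range (N + 1)).filter (fun p => ¬ p.1 + p.2 ≤ N),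
      X p =O[𝓝 ((0, t₀, z₀) : ℝ × ℝ × P)] fun q => ‖q.1‖ ^ (N + 1) := by
    intro p hp
    have hdeg : N + 1 ≤ p.1 + p.2 := by
      simp only [Finset.mem_filter] at hp; omega
    have hc : ContinuousAt (fun q : ℝ × ℝ × P => ∑ k : Fin 3,
        ((-(3 : ℝ) / 2 * q.2.1) ^ p.2 * q.2.1 ^ (k : ℕ) / ((p.1 ! : ℝ) * p.2 !)) • d p.2 p.1 k (q.2.1, q.2.2))
        ((0, t₀, z₀) : ℝ × ℝ × P) := by
      refine (continuous_finsetSum _ fun k _ => ?_).continuousAt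
      exact ((((continuous_const.mul (continuous_fst.comp continuous_snd)).pow _).mul
        ((continuous_fst.comp continuous_snd).pow _)).div_const _).smul
          ((hdc p.2 p.1 k).comp ((continuous_fst.comp continuous_snd).prodMk
            (continuous_snd.comp continuous_snd)))
    refine ((isBigO_fst_pow_smul_of_continuousAt hc (p.1 + p.2)).congr_left fun q => ?_).trans
      (isBigO_norm_fst_pow_of_le t₀ z₀ hdeg)
    simp only [hX, Finset.smul_sum, smul_smul, mul_div_assoc]
  -- the algebraic identity: the `u`-Taylor polynomial of `H` is the triangular part of `Σ X`
  have hbinom : ∀ p : ℕ × ℕ, ((p.1 + p.2).choose p.1 : ℝ) / ((p.1 + p.2) ! : ℝ) = 1 / ((p.1 ! : ℝ) * p.2 !) := by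
    intro p
    have h := Nat.add_choose_mul_factorial_mul_factorial p.1 p.2
    rw [← Nat.choose_symm_add] at h
    have h1 : ((p.1 + p.2).choose p.1 : ℝ) * p.1 ! * p.2 ! = (p.1 + p.2) ! := by exact_mod_cast h
    have hne1 : ((p.1 + p.2) ! : ℝ) ≠ 0 := by positivity
    have hne2 : (p.1 ! : ℝ) * p.2 ! ≠ 0 := by positivity
    rw [div_eq_div_iff hne1 hne2, one_mul, ← h1]
    ring
  have hA : ∀ q : ℝ × ℝ × P, ∑ m ∈ Finset.range (N + 1), (q.1 ^ m / (m ! : ℝ)) • h m q.2 =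
      ∑ m ∈ Finset.range (N + 1), ∑ p ∈ antidiagonal m, X p q := by
    intro q
    refine Finset.sum_congr rfl fun m _ => ?_
    change (q.1 ^ m / (m ! : ℝ)) • iteratedDeriv m (fun u => H (u, q.2.1, q.2.2)) 0 = _
    rw [← hEQ m q.2.1 q.2.2, Finset.smul_sum]
    refine Finset.sum_congr rfl fun p hp => ?_
    have hm : p.1 + p.2 = m := HasAntidiagonal.mem_antidiagonal.1 hp
    simp only [hX, Finset.smul_sum, smul_smul, hd]
    refine Finset.sum_congr rfl fun k _ => ?_
    rw [← hm]
    congr 1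
    -- both sides are the same monomial up to the binomial identity `C(a+b,a)/(a+b)! = 1/(a! b!)`
    calc q.1 ^ (p.1 + p.2) / ((p.1 + p.2) ! : ℝ) *
          (((p.1 + p.2).choose p.1 : ℝ) * ((-(3 : ℝ) / 2 * q.2.1) ^ p.2 * q.2.1 ^ (k : ℕ)))
        = q.1 ^ (p.1 + p.2) * ((-(3 : ℝ) / 2 * q.2.1) ^ p.2 * q.2.1 ^ (k : ℕ)) *
          (((p.1 + p.2).choose p.1 : ℝ) / ((p.1 + p.2) ! : ℝ)) := by ring
      _ = q.1 ^ (p.1 + p.2) * ((-(3 : ℝ) / 2 * q.2.1) ^ p.2 * q.2.1 ^ (k : ℕ)) *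
          (1 / ((p.1 ! : ℝ) * p.2 !)) := by rw [hbinom p]
      _ = q.1 ^ (p.1 + p.2) * ((-(3 : ℝ) / 2 * q.2.1) ^ p.2 * q.2.1 ^ (k : ℕ) / ((p.1 ! : ℝ) * p.2 !)) := by
          ring
  have hB : ∀ q : ℝ × ℝ × P, ∑ p ∈ Finset.range (N + 1) ×ˢ Finset.range (N + 1), X p q =
      ∑ k : Fin 3, ∑ n ∈ Finset.range (N + 1), q.2.1 ^ (k : ℕ) • ((q.1 ^ n / (n ! : ℝ)) •
        ∑ b ∈ Finset.range (N + 1), ((-(3 : ℝ) / 2 * q.2.1 * q.1) ^ b / (b ! : ℝ)) • d b n k (q.2.1, q.2.2)) := by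
    intro q
    simp only [hX, Finset.smul_sum, smul_smul]
    rw [Finset.sum_product]
    conv_rhs => rw [Finset.sum_comm]
    refine Finset.sum_congr rfl fun n _ => ?_
    conv_rhs => rw [Finset.sum_comm]
    refine Finset.sum_congr rfl fun b _ => Finset.sum_congr rfl fun k _ => ?_
    congr 1
    have hne1 : (n ! : ℝ) ≠ 0 := by positivity
    have hne2 : (b ! : ℝ) ≠ 0 := by positivity
    field_simp
    ring
  -- assemble at order `N + 1`
  have hT2s := IsBigO.sum (s := (Finset.univ : Finset (Fin 3))) fun k _ => hT2 k
  have hT3s := IsBigO.sum (s := (Finset.univ : Finset (Fin 3))) fun k _ =>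
    IsBigO.sum (s := Finset.range (N + 1)) fun n _ => hT3 k n
  have hT4s := IsBigO.sum hT4
  have hmain : (fun q : ℝ × ℝ × P => H q -
      ∑ k : Fin 3, q.2.1 ^ (k : ℕ) • W k (q.1, (q.2.1 ^ 3 - 3 * q.1 * q.2.1) / 2, q.2.2))
      =O[𝓝 ((0, t₀, z₀) : ℝ × ℝ × P)] fun q => ‖q.1‖ ^ (N + 1) := by
    refine (((hT1.sub hT2s).sub hT3s).sub hT4s).congr' (Eventually.of_forall fun q => ?_) EventuallyEq.rfl
    have h4 := sum_range_sq_eq_sum_antidiagonal_add (fun p => X p q) N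
    have hsplit : ∑ m ∈ Finset.range (N + 1), ∑ p ∈ antidiagonal m, X p q =
        ∑ k : Fin 3, ∑ n ∈ Finset.range (N + 1), q.2.1 ^ (k : ℕ) • ((q.1 ^ n / (n ! : ℝ)) •
          ∑ b ∈ Finset.range (N + 1), ((-(3 : ℝ) / 2 * q.2.1 * q.1) ^ b / (b ! : ℝ)) • d b n k (q.2.1, q.2.2)) -
        ∑ p ∈ (Finset.range (N + 1) ×ˢ Finset.range (N + 1)).filter (fun p => ¬ p.1 + p.2 ≤ N), X p q := by
      rw [← hB q, h4]
      abel
    dsimp only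
    rw [hA q, hsplit]
    simp only [smul_sub, Finset.sum_sub_distrib, Finset.smul_sum]
    abel
  exact hmain.trans (isBigO_norm_fst_pow_of_le t₀ z₀ (Nat.le_succ N))

end Literature.Analysis.Calculus

end
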